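import Mathlib.RingTheory.Polynomial.Cyclotomic.Roots
import Mathlib.RingTheory.RootsOfUnity.Complex
import Mathlib.FieldTheory.IntermediateField.Adjoin.Basic
import Mathlib.FieldTheory.IntermediateField.Algebraic
import Mathlib.FieldTheory.Minpoly.Finite
import Mathlib.Analysis.Fourier.FiniteAbelian.PontryaginDuality
import Mathlib.GroupTheory.OrderOfElement
import HarnessLib

/-!
# No primitive cube root of unity among the character values of a group of order prime to `3`

ω-census `pub-omega`, family (b3), seat pub-omega-group gen 6.  Framing: lottery ticket; floor = certified bounds/negative
ranges.  VALUE: an algebraic lemma used by the structure theorem for domino cube law triples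
(`DominoStructureChar.lean`); NOT progress on ω.

**Lemma Ω (`charsum_sq_add_mul_add_sq_eq_zero`).** Let `A` be a finite abelian group with `3 ∤ |A|`, `ψ : AddChar A ℂ`,
and `z₀ = ∑_{a ∈ X} ψ a`, `z₁ = ∑_{a ∈ Y} ψ a` for finite sets `X, Y ⊆ A`.  If `z₀² + z₀ z₁ + z₁² = 0` then `z₀ = z₁ = 0`.

*Proof.* All values `ψ a` are `n`-th roots of unity (`n = |A|`), hence lie in `K = ℚ(μ) ⊂ ℂ`, `μ = e^{2πi/n}`; so do
`z₀, z₁`.  If `z₁ ≠ 0` then `λ = z₀/z₁ ∈ K` satisfies `λ² + λ + 1 = 0`, so `λ` is a primitive cube root of unity and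
`K` contains `e^{2πi/3}`; with `3a + nb = 1` it then contains the primitive `3n`-th root `ζ = e^{2πi/(3n)} = μ^a ω^b`,
whose minimal polynomial over `ℚ` has degree `φ(3n) = 2φ(n) > φ(n) = [K : ℚ]` — contradiction.
-/

namespace Summit.MatrixMultiplication.OmegaCensus

open Polynomial IntermediateField Complex

/-- If `3 ∤ n` (`n ≥ 1`), the field `ℚ(μ) ⊂ ℂ` generated by the primitive `n`-th root of unity `μ = ζ³`,
`ζ = e^{2πi/(3n)}`, does not contain the primitive cube root of unity `ζⁿ`. [folklore] -/
theorem zeta_pow_not_mem_adjoin (n : ℕ) (hn : 0 < n) (h3 : ¬ 3 ∣ n) :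
    (Complex.exp (2 * Real.pi * Complex.I / (3 * n : ℕ))) ^ n ∉
      ℚ⟮(Complex.exp (2 * Real.pi * Complex.I / (3 * n : ℕ))) ^ 3⟯ := by
  set ζ : ℂ := Complex.exp (2 * Real.pi * Complex.I / (3 * n : ℕ)) with hζdef
  have h3n : 0 < 3 * n := by omega
  have hζ : IsPrimitiveRoot ζ (3 * n) := Complex.isPrimitiveRoot_exp (3 * n) h3n.ne'
  have hμ : IsPrimitiveRoot (ζ ^ 3) n := hζ.pow h3n rfl
  set K := ℚ⟮ζ ^ 3⟯ with hKdef
  intro hω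
  -- `ζ ∈ K` via Bézout `3a + nb = 1`
  have hcop : Nat.Coprime 3 n := (Nat.Prime.coprime_iff_not_dvd Nat.prime_three).2 h3
  obtain ⟨a, b, hab⟩ : ∃ a b : ℤ, a * 3 + b * n = 1 := by
    have := Nat.isCoprime_iff_coprime.mpr hcop
    obtain ⟨a, b, h⟩ := this
    exact ⟨a, b, by simpa using h⟩
  have hζ0 : ζ ≠ 0 := hζ.ne_zero (by omega)
  have hζK : ζ ∈ K := by
    have e : (ζ ^ 3) ^ a * (ζ ^ n) ^ b = ζ := by
      have h1 : ((3 : ℕ) : ℤ) * a + ((n : ℕ) : ℤ) * b = 1 := by push_cast; linarith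
      rw [← zpow_natCast ζ 3, ← zpow_natCast ζ n, ← zpow_mul, ← zpow_mul, ← zpow_add₀ hζ0, h1, zpow_one]
    rw [← e]
    exact mul_mem (zpow_mem (mem_adjoin_simple_self ℚ (ζ ^ 3)) a) (zpow_mem hω b)
  -- degrees
  have hint : IsIntegral ℚ (ζ ^ 3) := (hμ.isIntegral hn).tower_top
  haveI : FiniteDimensional ℚ K := adjoin.finiteDimensional hint
  have hfin : Module.finrank ℚ K = Nat.totient n := by
    rw [hKdef, adjoin.finrank hint, ← cyclotomic_eq_minpoly_rat hμ hn, natDegree_cyclotomic]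
  have hle : (minpoly ℚ ζ).natDegree ≤ Module.finrank ℚ K := by
    have h1 := minpoly.natDegree_le (A := ℚ) (⟨ζ, hζK⟩ : K)
    have h2 : minpoly ℚ (⟨ζ, hζK⟩ : K) = minpoly ℚ ζ := IntermediateField.minpoly_eq (⟨ζ, hζK⟩ : K)
    rwa [h2] at h1
  rw [← cyclotomic_eq_minpoly_rat hζ h3n, natDegree_cyclotomic, hfin,
    Nat.totient_mul hcop, Nat.totient_prime Nat.prime_three] at hle
  have hpos : 0 < Nat.totient n := Nat.totient_pos.mpr hn
  omega

variable {A : Type*} [AddCommGroup A] [Fintype A]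

/-- Every value of an additive character of a finite abelian group `A` lies in `ℚ(μ)`, `μ` a primitive `|A|`-th root
of unity (here `μ = ζ³`, `ζ = e^{2πi/(3|A|)}`). [folklore] -/
theorem addChar_apply_mem_adjoin (ψ : AddChar A ℂ) (a : A) :
    ψ a ∈ ℚ⟮(Complex.exp (2 * Real.pi * Complex.I / (3 * Fintype.card A : ℕ))) ^ 3⟯ := by
  set n := Fintype.card A with hndef
  have hn : 0 < n := Fintype.card_pos
  set ζ : ℂ := Complex.exp (2 * Real.pi * Complex.I / (3 * n : ℕ)) with hζdef
  have h3n : 0 < 3 * n := by omega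
  have hζ : IsPrimitiveRoot ζ (3 * n) := Complex.isPrimitiveRoot_exp (3 * n) h3n.ne'
  have hμ : IsPrimitiveRoot (ζ ^ 3) n := hζ.pow h3n rfl
  have hpow : ψ a ^ n = 1 := by
    rw [← AddChar.map_nsmul_eq_pow, hndef, card_nsmul_eq_zero, AddChar.map_zero_eq_one]
  haveI : NeZero n := ⟨hn.ne'⟩
  obtain ⟨i, -, hi⟩ := hμ.eq_pow_of_pow_eq_one hpow
  rw [← hi]
  exact pow_mem (mem_adjoin_simple_self ℚ (ζ ^ 3)) i

/-- A character sum of a finite abelian group lies in `ℚ(μ)`. [folklore] -/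
theorem charsum_mem_adjoin (ψ : AddChar A ℂ) (X : Finset A) :
    (∑ a ∈ X, ψ a) ∈ ℚ⟮(Complex.exp (2 * Real.pi * Complex.I / (3 * Fintype.card A : ℕ))) ^ 3⟯ :=
  sum_mem fun a _ => addChar_apply_mem_adjoin ψ a

/-- **Lemma Ω.** If `3 ∤ |A|` then two character sums `z₀, z₁` of `A` with `z₀² + z₀z₁ + z₁² = 0` both vanish
(equivalently: the ratio of two non-zero character sums is never a primitive cube root of unity). [folklore] -/
theorem charsum_sq_add_mul_add_sq_eq_zero (h3 : ¬ 3 ∣ Fintype.card A) (ψ : AddChar A ℂ) (X Y : Finset A)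
    (h : (∑ a ∈ X, ψ a) ^ 2 + (∑ a ∈ X, ψ a) * (∑ a ∈ Y, ψ a) + (∑ a ∈ Y, ψ a) ^ 2 = 0) :
    (∑ a ∈ X, ψ a) = 0 ∧ (∑ a ∈ Y, ψ a) = 0 := by
  set n := Fintype.card A with hndef
  have hn : 0 < n := Fintype.card_pos
  set ζ : ℂ := Complex.exp (2 * Real.pi * Complex.I / (3 * n : ℕ)) with hζdef
  have h3n : 0 < 3 * n := by omega
  have hζ : IsPrimitiveRoot ζ (3 * n) := Complex.isPrimitiveRoot_exp (3 * n) h3n.ne'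
  have hω : IsPrimitiveRoot (ζ ^ n) 3 := hζ.pow h3n (by ring)
  set K := ℚ⟮ζ ^ 3⟯ with hKdef
  set z₀ := ∑ a ∈ X, ψ a with hz₀
  set z₁ := ∑ a ∈ Y, ψ a with hz₁
  have hz₀K : z₀ ∈ K := charsum_mem_adjoin ψ X
  have hz₁K : z₁ ∈ K := charsum_mem_adjoin ψ Y
  by_cases hz1 : z₁ = 0
  · refine ⟨?_, hz1⟩
    rw [hz1, mul_zero, add_zero, zero_pow two_ne_zero, add_zero] at h
    exact pow_eq_zero_iff two_ne_zero |>.mp h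
  · exfalso
    set l := z₀ / z₁ with hl
    have hlK : l ∈ K := div_mem hz₀K hz₁K
    have hl2 : l ^ 2 + l + 1 = 0 := by
      have : (l ^ 2 + l + 1) * z₁ ^ 2 = z₀ ^ 2 + z₀ * z₁ + z₁ ^ 2 := by
        rw [hl]; field_simp
      have hz : z₁ ^ 2 ≠ 0 := pow_ne_zero 2 hz1
      have := this.trans h
      exact (mul_eq_zero.mp this).resolve_right hz
    have hl3 : l ^ 3 = 1 := by
      have : l ^ 3 - 1 = (l - 1) * (l ^ 2 + l + 1) := by ring
      rw [hl2, mul_zero] at this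
      exact sub_eq_zero.mp this
    have hl1 : l ≠ 1 := by
      intro h1; rw [h1] at hl2; norm_num at hl2
    haveI : NeZero (3 : ℕ) := ⟨by norm_num⟩
    obtain ⟨i, hi, hil⟩ := hω.eq_pow_of_pow_eq_one hl3
    -- `i ∈ {1, 2}` and then `ζ^n ∈ K`
    have hωK : ζ ^ n ∈ K := by
      interval_cases i
      · exfalso; rw [pow_zero] at hil; exact hl1 hil.symm
      · rw [pow_one] at hil; rw [hil]; exact hlK
      · -- `ζ^n = ((ζ^n)^2)^2` since `(ζ^n)^3 = 1`
        have h1 : (ζ ^ n) ^ 3 = 1 := hω.pow_eq_one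
        have e : ζ ^ n = ((ζ ^ n) ^ 2) ^ 2 := by
          have : ((ζ ^ n) ^ 2) ^ 2 = (ζ ^ n) ^ 3 * ζ ^ n := by ring
          rw [this, h1, one_mul]
        rw [e, hil]
        exact pow_mem hlK 2
    exact zeta_pow_not_mem_adjoin n hn h3 hωK

end Summit.MatrixMultiplication.OmegaCensus
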